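import Summits.ABC.ABC.Theses.CongruentialReceptacle
import HarnessLib

/-!
# Route CongruentialReceptacle — item `Assembly` (stmt-ABC-1728)

`Summit.ABC.ABC.Theses.CongruentialReceptacle.Assembly := BalancedFreySzpiro → CompactBalanceTransfer → ABC`.

The route's target `BalancedFreySzpiro` is Szpiro's exponent `6 + ε` for the Frey curves of COMPACTLY
BALANCED abc triples, in elementary currency: for every `κ > 0`, `ε > 0` there is `C` with
`(abc)² ≤ C · rad(abc)^(6+ε)` whenever `a + b = c` is an abc triple with `κc ≤ a` and `κc ≤ b`.
The crux `CompactBalanceTransfer` says that abc with exponent `1 + ε` on every such cell implies abc.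
The assembly is therefore the elementary glue between the two currencies on one cell:

* on the cell, `a, b ≥ κc` gives `(abc)² ≥ κ⁴ c⁶` (`balanced_pow_six_le`);
* applying the target at `(κ, 6ε)`: `κ⁴ c⁶ ≤ (abc)² ≤ max(C₀,1) · (rad^(1+ε))⁶`, so with
  `K := (max(C₀,1)/κ⁴)^(1/6)` we get `c⁶ ≤ (K · rad^(1+ε))⁶`, hence `c ≤ K · rad^(1+ε) < (K+1) · rad^(1+ε)`
  because `rad(abc) ≥ 1` (`balancedABC_of_balancedFreySzpiro`);
* feed this hypothesis to the transfer (`congruentialReceptacle_assembly_proof`).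

Pure `Real.rpow` bookkeeping; no named facts, standard axioms. (The same computation is the route file's
planner-authored deciding theorem `closes`; this file is deliberately self-contained so that it depends on
the three definitions only.) [folklore]
-/

-- `Summit.<Summit>.<Problem>` is the mandated summit-side namespace (CONVENTIONS §2); for the
-- single-conjunct summit `ABC` the two coincide, so the duplicate `ABC.ABC` is deliberate.
set_option linter.dupNamespace false

namespace Summit.ABC.ABC.Theorems

open Literature.NumberTheory.DiophantineGeometry
open Summit.ABC.ABC.Theses.CongruentialReceptacle

/-- On the compactly balanced cell the product currency dominates the `c`-currency:
`κc ≤ a`, `κc ≤ b` (with `κ ≥ 0`) give `κ⁴ · c⁶ ≤ (abc)²` (all read in `ℝ`). [folklore] -/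
theorem balanced_pow_six_le {κ : ℝ} (hκ : 0 ≤ κ) {a b c : ℕ}
    (ha : κ * (c : ℝ) ≤ (a : ℝ)) (hb : κ * (c : ℝ) ≤ (b : ℝ)) :
    κ ^ 4 * (c : ℝ) ^ 6 ≤ ((a * b * c : ℕ) : ℝ) ^ 2 := by
  have hc0 : (0 : ℝ) ≤ (c : ℝ) := Nat.cast_nonneg c
  have hκc : (0 : ℝ) ≤ κ * (c : ℝ) := mul_nonneg hκ hc0
  have habc_cast : ((a * b * c : ℕ) : ℝ) = (a : ℝ) * (b : ℝ) * (c : ℝ) := by push_cast; ring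
  have hlow : κ ^ 2 * (c : ℝ) ^ 3 ≤ (a : ℝ) * (b : ℝ) * (c : ℝ) := by
    have h1 : κ * (c : ℝ) * (κ * (c : ℝ)) ≤ (a : ℝ) * (b : ℝ) :=
      mul_le_mul ha hb hκc (Nat.cast_nonneg a)
    calc κ ^ 2 * (c : ℝ) ^ 3 = (κ * (c : ℝ) * (κ * (c : ℝ))) * (c : ℝ) := by ring
      _ ≤ (a : ℝ) * (b : ℝ) * (c : ℝ) := mul_le_mul_of_nonneg_right h1 hc0
  have h0 : (0 : ℝ) ≤ κ ^ 2 * (c : ℝ) ^ 3 := by positivity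
  rw [habc_cast]
  calc κ ^ 4 * (c : ℝ) ^ 6 = (κ ^ 2 * (c : ℝ) ^ 3) ^ 2 := by ring
    _ ≤ ((a : ℝ) * (b : ℝ) * (c : ℝ)) ^ 2 := pow_le_pow_left₀ h0 hlow 2

/-- **Currency change on the compactly balanced cell.** `BalancedFreySzpiro` (Szpiro `6 + ε` for the
Frey curves of compactly balanced abc triples, in the elementary currency `(abc)² ≤ C · rad(abc)^(6+ε)`)
implies abc with exponent `1 + ε` on every compactly balanced cell `min(a, b) ≥ κc` — exactly the
hypothesis of the crux `CompactBalanceTransfer`. Proof: apply the target at `(κ, 6ε)`; with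
`K := (max(C₀,1)/κ⁴)^(1/6)` the bound `κ⁴c⁶ ≤ (abc)² ≤ max(C₀,1) · (rad^(1+ε))⁶` is `c⁶ ≤ (K · rad^(1+ε))⁶`,
so `c ≤ K · rad^(1+ε) < (K + 1) · rad^(1+ε)` as `rad(abc) > 0`. [folklore] -/
theorem balancedABC_of_balancedFreySzpiro (hX : BalancedFreySzpiro) :
    ∀ κ : ℝ, 0 < κ → ∀ ε : ℝ, 0 < ε → ∃ C : ℝ, ∀ a b c : ℕ, IsABCTriple a b c →
      κ * (c : ℝ) ≤ (a : ℝ) → κ * (c : ℝ) ≤ (b : ℝ) →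
        (c : ℝ) < C * ((rad a b c : ℕ) : ℝ) ^ (1 + ε) := by
  intro κ hκ ε hε
  obtain ⟨C₀, hC₀⟩ := hX κ hκ (6 * ε) (by positivity)
  have hκ4 : (0 : ℝ) < κ ^ 4 := by positivity
  have hMpos : (0 : ℝ) < max C₀ 1 := lt_of_lt_of_le one_pos (le_max_right _ _)
  have hMκ : (0 : ℝ) ≤ max C₀ 1 / κ ^ 4 := div_nonneg hMpos.le hκ4.le
  -- `K := (max C₀ 1 / κ⁴)^(1/6)`, answer `C := K + 1`.
  have hKnn : (0 : ℝ) ≤ (max C₀ 1 / κ ^ 4) ^ ((6 : ℕ) : ℝ)⁻¹ := Real.rpow_nonneg hMκ _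
  have hK6 : ((max C₀ 1 / κ ^ 4) ^ ((6 : ℕ) : ℝ)⁻¹) ^ 6 = max C₀ 1 / κ ^ 4 :=
    Real.rpow_inv_natCast_pow hMκ (by norm_num)
  refine ⟨(max C₀ 1 / κ ^ 4) ^ ((6 : ℕ) : ℝ)⁻¹ + 1, ?_⟩
  intro a b c habc ha hb
  have h := hC₀ a b c habc ha hb
  have hRpos : (0 : ℝ) < ((rad a b c : ℕ) : ℝ) := by
    have h0 : 0 < rad a b c := by
      rw [rad_def]
      exact Nat.pos_of_ne_zero UniqueFactorizationMonoid.radical_ne_zero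
    exact_mod_cast h0
  have hRnn : (0 : ℝ) ≤ ((rad a b c : ℕ) : ℝ) := hRpos.le
  have hSpos : (0 : ℝ) < ((rad a b c : ℕ) : ℝ) ^ (1 + ε) := Real.rpow_pos_of_pos hRpos _
  -- `rad^(6+6ε) = (rad^(1+ε))⁶`.
  have hS6 : ((rad a b c : ℕ) : ℝ) ^ (6 + 6 * ε) = (((rad a b c : ℕ) : ℝ) ^ (1 + ε)) ^ 6 := by
    rw [show (6 + 6 * ε : ℝ) = (1 + ε) * ((6 : ℕ) : ℝ) by push_cast; ring, Real.rpow_mul_natCast hRnn]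
  -- lower bound on the cell and upper bound from the target, in the product currency
  have hlow2 : κ ^ 4 * (c : ℝ) ^ 6 ≤ ((a * b * c : ℕ) : ℝ) ^ 2 := balanced_pow_six_le hκ.le ha hb
  have hup : ((a * b * c : ℕ) : ℝ) ^ 2 ≤ max C₀ 1 * (((rad a b c : ℕ) : ℝ) ^ (1 + ε)) ^ 6 := by
    rw [← hS6]
    exact h.trans (mul_le_mul_of_nonneg_right (le_max_left _ _) (Real.rpow_nonneg hRnn _))
  -- `c⁶ ≤ (K · rad^(1+ε))⁶`, then take sixth roots
  have hc6 : (c : ℝ) ^ 6 ≤ ((max C₀ 1 / κ ^ 4) ^ ((6 : ℕ) : ℝ)⁻¹ * ((rad a b c : ℕ) : ℝ) ^ (1 + ε)) ^ 6 := by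
    rw [mul_pow, hK6, div_mul_eq_mul_div, le_div_iff₀ hκ4]
    calc (c : ℝ) ^ 6 * κ ^ 4 = κ ^ 4 * (c : ℝ) ^ 6 := by ring
      _ ≤ max C₀ 1 * (((rad a b c : ℕ) : ℝ) ^ (1 + ε)) ^ 6 := hlow2.trans hup
  have hcle : (c : ℝ) ≤ (max C₀ 1 / κ ^ 4) ^ ((6 : ℕ) : ℝ)⁻¹ * ((rad a b c : ℕ) : ℝ) ^ (1 + ε) :=
    le_of_pow_le_pow_left₀ (by norm_num) (mul_nonneg hKnn hSpos.le) hc6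
  calc (c : ℝ) ≤ (max C₀ 1 / κ ^ 4) ^ ((6 : ℕ) : ℝ)⁻¹ * ((rad a b c : ℕ) : ℝ) ^ (1 + ε) := hcle
    _ < ((max C₀ 1 / κ ^ 4) ^ ((6 : ℕ) : ℝ)⁻¹ + 1) * ((rad a b c : ℕ) : ℝ) ^ (1 + ε) := by
      rw [add_mul, one_mul]
      exact lt_add_of_pos_right _ hSpos

/-- **Item stmt-ABC-1728 (`Assembly`) of route CongruentialReceptacle, proved.**
`BalancedFreySzpiro → CompactBalanceTransfer → ABC`: the currency change
`balancedABC_of_balancedFreySzpiro` turns the target into abc with exponent `1 + ε` on every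
compactly balanced cell, which is the hypothesis the transfer consumes. Unconditional; no named facts.
[folklore] -/
theorem congruentialReceptacle_assembly_proof :
    Summit.ABC.ABC.Theses.CongruentialReceptacle.Assembly := by
  unfold Summit.ABC.ABC.Theses.CongruentialReceptacle.Assembly
  intro hX hT
  exact hT (balancedABC_of_balancedFreySzpiro hX)

end Summit.ABC.ABC.Theorems
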